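import Summits.MatrixMultiplication.OmegaCensus.ThreeSetZ31Cells4420
import Summits.MatrixMultiplication.OmegaCensus.ThreeSetZ31Cells4516
import Summits.MatrixMultiplication.OmegaCensus.ThreeSetZ31Cells4810
import Summits.MatrixMultiplication.OmegaCensus.DominoNormCongruenceTPP
import Summits.MatrixMultiplication.OmegaCensus.DihedralLawModOneOrder784
import Summits.MatrixMultiplication.OmegaCensus.DihedralLawModOneOrder961Arith
import HarnessLib

/-!
# ORDER 961 — `Dih(ℤ_31²)` attains no law, MODULO the one residual cube shape `(5,8,8)`: the `|A| = 961` line as ONE kernel theorem with ONE named hypothesis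

ω-census `pub-omega`, family (b3), seat pub-omega-group gen 42 (ruling L44-1 (b)).  Framing: lottery ticket; floor = certified
bounds/negative ranges.  VALUE: the census line `|A| = 961` assembled in the kernel: no dihedral-like group over an abelian group `A`
of order `961` mapping onto `ℤ_31²` (`A = ℤ_31²`) has a TPP triple attaining `3|S||T||U| + 8 = 8|A|` — for EVERY part shape except
the cube shape `(5,8,8)` (and its orderings), which enters as the single explicit named hypothesis `NoCube588Order961` (a `def … :
Prop`, consumed as a hypothesis, never an axiom or instance).  That shape is census-grade NONE ×1 (g29, kit j284440: 146 706 070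
frames, complete 0) but has no kernel route yet (all its parts are `≥ 5`; the frame/cover machinery `ThreeSetZpFrame4` is `|W| = 4` only).
Assembly (`cube_shape_of_961`: `stu = 320` ⇒ a part `1`, a part `2`, a part `4` next to a part `4`, `5` or `8`, or an ordering of
`(5,8,8)`): non-cube shapes ⇒ two cosets of a cyclic subgroup (orders `≤ 31`); a part `1` by the norm congruence
(`no_domino_law_onto_zpzp_sq`, gen 30); a part `2` ⇒ an element of order `≥ |A|/2`; `(4,4,20)` by `no_law_cube_four_4_card961`
(`ThreeSetZ31Cells4420`, g40); `(4,5,16)` by `no_law_cube_four_5_card961`, `(4,8,10)` by `no_law_cube_four_8_card961`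
(`ThreeSetZ31Cells4516/4810`, bit-sliced mod-4 filter + parity kill, this seat).  NOT progress on ω.
-/

namespace Summit.MatrixMultiplication.OmegaCensus

open Literature.Combinatorics.Additive Finset

/-- **The residual of ORDER 961** (OPEN in the kernel; census grade NONE ×1): no TPP triple of a dihedral-like group over an
abelian `A` of order `961` with `A ↠ ℤ_31²`, with balanced coset parts of half-sizes `(5,8,8)` in some order, attains
`3|S||T||U| + 8 = 8|A|`.  A HYPOTHESIS of `no_mod_one_law_card_961_of_onto_z31z31`, not a cited fact. [folklore] -/
def NoCube588Order961 : Prop :=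
  ∀ (A : Type) [AddCommGroup A] [DecidableEq A] [Fintype A] (G : Type) [Group G] [DecidableEq G]
    (ρ τ : A → G) (c₀ : A) (S T U : Finset G),
    Fintype.card A = 961 →
    (∀ a b, ρ a * ρ b = ρ (a + b)) → (∀ a b, ρ a * τ b = τ (b - a)) →
    (∀ a b, τ a * ρ b = τ (a + b)) → (∀ a b, τ a * τ b = ρ (c₀ + b - a)) →
    Function.Injective ρ → Function.Injective τ → (∀ a b, ρ a ≠ τ b) → (∀ g, (∃ a, ρ a = g) ∨ (∃ a, τ a = g)) →
    (∃ Φ : A →+ ZMod 31 × ZMod 31, Function.Surjective Φ) →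
    TripleProductProperty S T U →
    (univ.filter fun a : A => ρ a ∈ S).card = (univ.filter fun a : A => τ a ∈ S).card →
    (univ.filter fun a : A => ρ a ∈ T).card = (univ.filter fun a : A => τ a ∈ T).card →
    (univ.filter fun a : A => ρ a ∈ U).card = (univ.filter fun a : A => τ a ∈ U).card →
    (((univ.filter fun a : A => ρ a ∈ S).card = 5 ∧ (univ.filter fun a : A => ρ a ∈ T).card = 8 ∧
        (univ.filter fun a : A => ρ a ∈ U).card = 8) ∨
      ((univ.filter fun a : A => ρ a ∈ S).card = 8 ∧ (univ.filter fun a : A => ρ a ∈ T).card = 5 ∧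
        (univ.filter fun a : A => ρ a ∈ U).card = 8) ∨
      ((univ.filter fun a : A => ρ a ∈ S).card = 8 ∧ (univ.filter fun a : A => ρ a ∈ T).card = 8 ∧
        (univ.filter fun a : A => ρ a ∈ U).card = 5)) →
    3 * (S.card * T.card * U.card) + 8 ≠ 8 * Fintype.card A

section DihedralLike

variable {A : Type} [AddCommGroup A] [DecidableEq A] [Fintype A] {G : Type} [Group G] [DecidableEq G]
  {ρ τ : A → G} {c₀ : A} {S T U : Finset G}

/-- **No law over `A` of order `961` with `A ↠ ℤ_31²`** (any presentation constant `c₀`), given the residual `NoCube588Order961`.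
[folklore] -/
theorem no_mod_one_law_card_961_of_onto_z31z31 (h588 : NoCube588Order961) (hA : Fintype.card A = 961)
    (hρρ : ∀ a b, ρ a * ρ b = ρ (a + b)) (hρτ : ∀ a b, ρ a * τ b = τ (b - a))
    (hτρ : ∀ a b, τ a * ρ b = τ (a + b)) (hττ : ∀ a b, τ a * τ b = ρ (c₀ + b - a))
    (hρ : Function.Injective ρ) (hτ : Function.Injective τ) (hne : ∀ a b, ρ a ≠ τ b)
    (hsurj : ∀ g, (∃ a, ρ a = g) ∨ (∃ a, τ a = g))
    (Φ : A →+ ZMod 31 × ZMod 31) (hΦ : Function.Surjective Φ) (h : TripleProductProperty S T U) :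
    3 * (S.card * T.card * U.card) + 8 ≠ 8 * Fintype.card A := by
  haveI : Fact (Nat.Prime 31) := ⟨by norm_num⟩
  intro hV
  have hA2 : Fintype.card A = 31 ^ 2 := by rw [hA]; norm_num
  have hexp : ∀ x : A, addOrderOf x ≤ 1 * 31 :=
    addOrderOf_le_of_onto_card (k := 1) (n := 31) Φ hΦ
      (by rw [Nat.card_eq_fintype_card, hA, Nat.card_prod, Nat.card_zmod])
      (fun q => by
        refine Prod.ext ?_ ?_
        · show 31 • q.1 = 0
          rw [nsmul_eq_mul, ZMod.natCast_self, zero_mul]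
        · show 31 • q.2 = 0
          rw [nsmul_eq_mul, ZMod.natCast_self, zero_mul])
      (by norm_num) (by norm_num)
  have big : ¬ ∃ g : A, Fintype.card A ≤ 2 * addOrderOf g := by
    rintro ⟨g, hg⟩; have := hexp g; rw [hA] at hg; omega
  have hmod : Fintype.card A % 3 = 1 := by rw [hA]
  have hA14 : 14 ≤ Fintype.card A := by rw [hA]; norm_num
  have hV_TUS : 3 * (T.card * U.card * S.card) + 8 = 8 * Fintype.card A := by
    rw [show T.card * U.card * S.card = S.card * T.card * U.card by ring]; exact hV
  have hV_UST : 3 * (U.card * S.card * T.card) + 8 = 8 * Fintype.card A := by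
    rw [show U.card * S.card * T.card = S.card * T.card * U.card by ring]; exact hV
  have hTUS : TripleProductProperty T U S := h.rotate
  have hUST : TripleProductProperty U S T := h.rotate.rotate
  have p31 : (31 : ℕ) = 5 ∨ (31 : ℕ) = 17 ∨ (31 : ℕ) = 19 ∨ (31 : ℕ) = 23 ∨ (31 : ℕ) = 29 ∨ (31 : ℕ) = 31 :=
    Or.inr (Or.inr (Or.inr (Or.inr (Or.inr rfl))))
  by_cases hnc : ((univ.filter fun a : A => ρ a ∈ S).card = (univ.filter fun a : A => τ a ∈ S).card ∧
      (univ.filter fun a : A => ρ a ∈ T).card = (univ.filter fun a : A => τ a ∈ T).card ∧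
      (univ.filter fun a : A => ρ a ∈ U).card = (univ.filter fun a : A => τ a ∈ U).card)
  · obtain ⟨hS', hT', hU'⟩ := hnc
    have cS := card_eq_parts' hρ hτ hne hsurj S
    have cT := card_eq_parts' hρ hτ hne hsurj T
    have cU := card_eq_parts' hρ hτ hne hsurj U
    set s₀ := (univ.filter fun a : A => ρ a ∈ S).card with hs₀
    set t₀ := (univ.filter fun a : A => ρ a ∈ T).card with ht₀
    set u₀ := (univ.filter fun a : A => ρ a ∈ U).card with hu₀
    have eS : S.card = 2 * s₀ := by rw [cS, ← hS']; ring
    have eT : T.card = 2 * t₀ := by rw [cT, ← hT']; ring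
    have eU : U.card = 2 * u₀ := by rw [cU, ← hU']; ring
    have hprod : 3 * (s₀ * t₀ * u₀) + 1 = 961 := by
      rw [eS, eT, eU, hA] at hV; nlinarith
    rcases cube_shape_of_961 hprod with h1 | h1 | h1 | h1 | h1 | h1 | h1 | h1 | h1 | h1 | h1 | h1 | h1 | h1 | h1 | h1 | h1 | h1 |
        h1 | h1 | h1 | h1 | h1 | h1
    · -- a part 1 at S: domino, norm congruence
      exact no_domino_law_onto_zpzp_sq hρρ hρτ hτρ hττ hρ hτ hne hsurj p31 Φ hΦ hA2 h h1 (hS'.symm.trans h1) hT' hU' hV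
    · exact no_domino_law_onto_zpzp_sq hρρ hρτ hτρ hττ hρ hτ hne hsurj p31 Φ hΦ hA2 hTUS h1 (hT'.symm.trans h1) hU' hS' hV_TUS
    · exact no_domino_law_onto_zpzp_sq hρρ hρτ hτρ hττ hρ hτ hne hsurj p31 Φ hΦ hA2 hUST h1 (hU'.symm.trans h1) hS' hT' hV_UST
    · -- a part 2 at S (|S| = 4): an element of order ≥ |A|/2
      exact big (card_le_two_mul_addOrderOf_of_mod_one_law_card_four hρρ hρτ hτρ hττ hρ hτ hne hsurj hmod hA14 hUST hV_UST (by rw [eS, h1]))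
    · exact big (card_le_two_mul_addOrderOf_of_mod_one_law_card_four hρρ hρτ hτρ hττ hρ hτ hne hsurj hmod hA14 h hV (by rw [eT, h1]))
    · exact big (card_le_two_mul_addOrderOf_of_mod_one_law_card_four hρρ hρτ hτρ hττ hρ hτ hne hsurj hmod hA14 hTUS hV_TUS (by rw [eU, h1]))
    · -- a part 4 next to a part 4: cell (4,4,20)@961
      exact absurd hV (no_law_cube_four_4_card961 hA hρρ hρτ hτρ hττ hρ hτ hne hsurj Φ hΦ h hS' hT' hU' (Or.inl h1))
    · exact absurd hV (no_law_cube_four_4_card961 hA hρρ hρτ hτρ hττ hρ hτ hne hsurj Φ hΦ h hS' hT' hU' (Or.inr (Or.inl h1)))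
    · exact absurd hV (no_law_cube_four_4_card961 hA hρρ hρτ hτρ hττ hρ hτ hne hsurj Φ hΦ h hS' hT' hU' (Or.inr (Or.inr (Or.inl h1))))
    · -- a part 4 next to a part 5: cell (4,5,16)@961
      exact absurd hV (no_law_cube_four_5_card961 hA hρρ hρτ hτρ hττ hρ hτ hne hsurj Φ hΦ h hS' hT' hU' (Or.inl h1))
    · exact absurd hV (no_law_cube_four_5_card961 hA hρρ hρτ hτρ hττ hρ hτ hne hsurj Φ hΦ h hS' hT' hU' (Or.inr (Or.inl h1)))
    · exact absurd hV (no_law_cube_four_5_card961 hA hρρ hρτ hτρ hττ hρ hτ hne hsurj Φ hΦ h hS' hT' hU' (Or.inr (Or.inr (Or.inl h1))))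
    · exact absurd hV (no_law_cube_four_5_card961 hA hρρ hρτ hτρ hττ hρ hτ hne hsurj Φ hΦ h hS' hT' hU'
        (Or.inr (Or.inr (Or.inr (Or.inl h1)))))
    · exact absurd hV (no_law_cube_four_5_card961 hA hρρ hρτ hτρ hττ hρ hτ hne hsurj Φ hΦ h hS' hT' hU'
        (Or.inr (Or.inr (Or.inr (Or.inr (Or.inl h1))))))
    · exact absurd hV (no_law_cube_four_5_card961 hA hρρ hρτ hτρ hττ hρ hτ hne hsurj Φ hΦ h hS' hT' hU'
        (Or.inr (Or.inr (Or.inr (Or.inr (Or.inr h1))))))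
    · -- a part 4 next to a part 8: cell (4,8,10)@961
      exact absurd hV (no_law_cube_four_8_card961 hA hρρ hρτ hτρ hττ hρ hτ hne hsurj Φ hΦ h hS' hT' hU' (Or.inl h1))
    · exact absurd hV (no_law_cube_four_8_card961 hA hρρ hρτ hτρ hττ hρ hτ hne hsurj Φ hΦ h hS' hT' hU' (Or.inr (Or.inl h1)))
    · exact absurd hV (no_law_cube_four_8_card961 hA hρρ hρτ hτρ hττ hρ hτ hne hsurj Φ hΦ h hS' hT' hU' (Or.inr (Or.inr (Or.inl h1))))
    · exact absurd hV (no_law_cube_four_8_card961 hA hρρ hρτ hτρ hττ hρ hτ hne hsurj Φ hΦ h hS' hT' hU'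
        (Or.inr (Or.inr (Or.inr (Or.inl h1)))))
    · exact absurd hV (no_law_cube_four_8_card961 hA hρρ hρτ hτρ hττ hρ hτ hne hsurj Φ hΦ h hS' hT' hU'
        (Or.inr (Or.inr (Or.inr (Or.inr (Or.inl h1))))))
    · exact absurd hV (no_law_cube_four_8_card961 hA hρρ hρτ hτρ hττ hρ hτ hne hsurj Φ hΦ h hS' hT' hU'
        (Or.inr (Or.inr (Or.inr (Or.inr (Or.inr h1))))))
    · -- the residual cube shape (5,8,8) and its orderings: the hypothesis
      exact h588 A G ρ τ c₀ S T U hA hρρ hρτ hτρ hττ hρ hτ hne hsurj ⟨Φ, hΦ⟩ h hS' hT' hU' (Or.inl h1) hV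
    · exact h588 A G ρ τ c₀ S T U hA hρρ hρτ hτρ hττ hρ hτ hne hsurj ⟨Φ, hΦ⟩ h hS' hT' hU' (Or.inr (Or.inl h1)) hV
    · exact h588 A G ρ τ c₀ S T U hA hρρ hρτ hτρ hττ hρ hτ hne hsurj ⟨Φ, hΦ⟩ h hS' hT' hU' (Or.inr (Or.inr h1)) hV
  · obtain ⟨g, a, b, hab⟩ :=
      two_cosets_of_mod_one_law_of_not_cube hρρ hρτ hτρ hττ hρ hτ hne hsurj hmod hA14 h hV hnc
    exact big ⟨g, card_le_two_mul_addOrderOf_of_two_cosets hab⟩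

end DihedralLike

section Instance

variable {G : Type} [Group G] [DecidableEq G] {S T U : Finset G}

open Literature.Combinatorics.Additive

/-- **`Dih(ℤ_31 × ℤ_31)` — and every dihedral-like group over `ℤ_31²` — has no TPP triple attaining `3|S||T||U| + 8 = 8|A|`**, given
the residual `NoCube588Order961` (the `|A| = 961` line of the classification 'law ⟹ an element of order `≥ |A|/2`'). [folklore] -/
theorem no_mod_one_law_z31_z31 (h588 : NoCube588Order961) {ρ τ : ZMod 31 × ZMod 31 → G} {c₀ : ZMod 31 × ZMod 31}
    (hρρ : ∀ a b, ρ a * ρ b = ρ (a + b)) (hρτ : ∀ a b, ρ a * τ b = τ (b - a))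
    (hτρ : ∀ a b, τ a * ρ b = τ (a + b)) (hττ : ∀ a b, τ a * τ b = ρ (c₀ + b - a))
    (hρ : Function.Injective ρ) (hτ : Function.Injective τ) (hne : ∀ a b, ρ a ≠ τ b)
    (hsurj : ∀ g, (∃ a, ρ a = g) ∨ (∃ a, τ a = g)) (h : TripleProductProperty S T U) :
    3 * (S.card * T.card * U.card) + 8 ≠ 8 * Fintype.card (ZMod 31 × ZMod 31) :=
  no_mod_one_law_card_961_of_onto_z31z31 h588 (by simp [Fintype.card_prod, ZMod.card]) hρρ hρτ hτρ hττ hρ hτ hne hsurj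
    (AddMonoidHom.id _) (fun q => ⟨q, rfl⟩) h

end Instance

end Summit.MatrixMultiplication.OmegaCensus
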